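import Summits.HodgeConjecture.HodgeConjecture.Cruxes.BlochSeedDiscOne.ShellThreePairLaw
import Summits.HodgeConjecture.HodgeConjecture.Cruxes.BlochSeedDiscOne.ShellThreeDoorB

/-!
# Shell-3 face of the dual certificate family, III: the §11 SUPPORT HYPOTHESES DISCHARGED FROM gs-eng-2 (B)

`line stmt-HodgeConjecture-18881 Cruxes/BlochSeedDiscOne/Lines/birth.lean 814a6a70c14e831a stub_rung_pad4_seedAt`
(plan-lens-HodgeAV-dual g16, 2026-08-31; needs BOTH `ShellThreePairLaw` v11 @6387f7144c08 (the mass laws) and `ShellThreeDoorB`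
@72eed19ae9d6 (the coarse door under (B)); PUBLISHED by dual g17 on 2026-08-31 once both were farm-built — g16 draft
46d2505e2dcdadef unchanged except one `open … RingTwoMassLaw.ClassLaw (E dep)` line).  KERNEL STATEMENTS ONLY — no `sorry`, no new axiom, no `instance`, no `notation`,
no `native_decide`.  **Nothing here is proved toward HC / HC_CM / HC_AV / №4 / 26512 / 18881 / H2**: (B) is a DISPLAYED BINDER
(`ShellThreeDoorB.HubfreePB`), everything else is coarse RULE D + `Disj` + alphabet + ring 3 + clauses 1–2 of (A1).

CONTENTS (all under `D.OnAlphabet h`, `Disj`, `RuleD`, `Ring3`, (B)): the §11 support hypotheses hold —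
`N_a2111_zero_B`, `N_a2210_zero_B`, `N_a2211_zero_B`, `N_a2220_zero_B`, `P_a2211_zero_B`; hence with (A1):
`hook_law_B` «2·Σ_P m a2111∘σ′ = 4·Σ_P m a2210∘σ for ALL σ, σ′» (the P `Buuu` mass read at any slot is twice the P
«off-axis pair × co-level» mass of any class), `hook_mass_placement_free`, `P_a2210_zero_of_noHook_B` «P Buuu = ∅ ⇒ every
supported P cell with an off-axis pair and a charged third letter is ABSENT, whatever its fourth letter (P BBHu, BDHu, ABBH, …)»,
its converse `P_a2111_zero_of_noPair_B`, `offaxis_triple_free_B` (no P off-axis triple), and with §11c `hubfreeN_onAxis_of_E_eq`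
(at `E = −8` under the cover inequality the forced hub-free N cell is on-axis at every slot). -/

set_option linter.dupNamespace false
set_option autoImplicit false

namespace Summit.HodgeConjecture.HodgeConjecture.Cruxes.BlochSeedDiscOne.ShellThreePropagationB

open Summit.HodgeConjecture.HodgeConjecture.Cruxes.BlochSeedDiscOne.DepthBoundA4
open Summit.HodgeConjecture.HodgeConjecture.Cruxes.BlochSeedDiscOne.RingFourEmpty
open Summit.HodgeConjecture.HodgeConjecture.Cruxes.BlochSeedDiscOne.RingTwoMassLaw
open Summit.HodgeConjecture.HodgeConjecture.Cruxes.BlochSeedDiscOne.RingTwoMassLaw.ClassLaw (E dep)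
open Summit.HodgeConjecture.HodgeConjecture.Cruxes.BlochSeedDiscOne.ShellThreePairLaw hiding OffAxis col_eq two_le_colevel_of_offAxis
open Summit.HodgeConjecture.HodgeConjecture.Cruxes.BlochSeedDiscOne.ShellThreeDoorB

section Discharge
open Summit.HodgeConjecture.HodgeConjecture.Cruxes.BlochSeedDiscOne.LeggedFloor

/-! ### Discharging the support hypotheses of §11 from (B) -/

theorem perm_ne (σ : Equiv.Perm (Fin 4)) {i j : Fin 4} (h : i ≠ j) : σ i ≠ σ j := fun e => h (σ.injective e)

/-- under (B): `a2111∘σ` vanishes on the N support (no N off-axis hook), at EVERY placement. -/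
theorem N_a2111_zero_B {h : ℤ} {D : Design} (hD : D.OnAlphabet h) (hr : RuleD D) (hdis : Disj D) (hB : HubfreePB D)
    (σ : Equiv.Perm (Fin 4)) : ∀ c ∈ D.suppN, a2111 σ c = 0 := by
  intro c hc
  by_contra hne
  unfold a2111 at hne
  obtain ⟨h012, h3⟩ := mul_ne_zero_iff.mp hne
  obtain ⟨h01, h2⟩ := mul_ne_zero_iff.mp h012
  obtain ⟨h0, h1⟩ := mul_ne_zero_iff.mp h01
  have hoff : OffAxis (c (σ 0)) := offAxis_of_absmul_ne_zero h0
  have c0 := two_le_colevel_of_offAxis _ hoff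
  have hfree : ∀ f : Fin 4, (c f).colevel ≠ 0 :=
    forall_slot_of_perm σ (P := fun f => (c f).colevel ≠ 0) (by omega) h1 h2 h3
  exact hubfreeN_onAxis hD hr hdis hB hc hfree (σ 0) hoff

/-- under (B): `a2211∘σ` vanishes on the N support. -/
theorem N_a2211_zero_B {h : ℤ} {D : Design} (hD : D.OnAlphabet h) (hr : RuleD D) (hdis : Disj D) (hB : HubfreePB D)
    (σ : Equiv.Perm (Fin 4)) : ∀ c ∈ D.suppN, a2211 σ c = 0 := by
  intro c hc
  by_contra hne
  unfold a2211 at hne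
  obtain ⟨h012, h3⟩ := mul_ne_zero_iff.mp hne
  obtain ⟨h01, h2⟩ := mul_ne_zero_iff.mp h012
  obtain ⟨h0, h1⟩ := mul_ne_zero_iff.mp h01
  have ho0 : OffAxis (c (σ 0)) := offAxis_of_absmul_ne_zero h0
  have ho1 : OffAxis (c (σ 1)) := offAxis_of_absmul_ne_zero h1
  have c0 := two_le_colevel_of_offAxis _ ho0
  have c1 := two_le_colevel_of_offAxis _ ho1
  have hfree : ∀ f : Fin 4, (c f).colevel ≠ 0 :=
    forall_slot_of_perm σ (P := fun f => (c f).colevel ≠ 0) (by omega) (by omega) h2 h3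
  exact hubfreeN_onAxis hD hr hdis hB hc hfree (σ 0) ho0

/-- under (B): `a2211∘σ` vanishes on the P support (a hub-free P cell with an off-axis letter has units elsewhere). -/
theorem P_a2211_zero_B {D : Design} (hB : HubfreePB D) (σ : Equiv.Perm (Fin 4)) : ∀ c ∈ D.suppP, a2211 σ c = 0 := by
  intro c hc
  by_contra hne
  unfold a2211 at hne
  obtain ⟨h012, h3⟩ := mul_ne_zero_iff.mp hne
  obtain ⟨h01, h2⟩ := mul_ne_zero_iff.mp h012
  obtain ⟨h0, h1⟩ := mul_ne_zero_iff.mp h01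
  have ho0 : OffAxis (c (σ 0)) := offAxis_of_absmul_ne_zero h0
  have ho1 : OffAxis (c (σ 1)) := offAxis_of_absmul_ne_zero h1
  have c0 := two_le_colevel_of_offAxis _ ho0
  have c1 := two_le_colevel_of_offAxis _ ho1
  have hfree : ∀ f : Fin 4, (c f).colevel ≠ 0 :=
    forall_slot_of_perm σ (P := fun f => (c f).colevel ≠ 0) (by omega) (by omega) h2 h3
  have h4 := (hB c hc hfree).2 (σ 0) (σ 1) (perm_ne σ (by decide)) ho0
  omega

/-- under (B) (+ ring 3): `a2210∘σ` vanishes on the N support — no N cell is off-axis on a pair with a charged third letter. -/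
theorem N_a2210_zero_B {h : ℤ} {D : Design} (hD : D.OnAlphabet h) (hr : RuleD D) (hdis : Disj D) (h3 : Ring3 D)
    (hB : HubfreePB D) (σ : Equiv.Perm (Fin 4)) : ∀ c ∈ D.suppN, a2210 σ c = 0 := by
  intro c hc
  by_contra hne
  unfold a2210 at hne
  obtain ⟨h01, h2⟩ := mul_ne_zero_iff.mp hne
  obtain ⟨h0, h1⟩ := mul_ne_zero_iff.mp h01
  have ho0 : OffAxis (c (σ 0)) := offAxis_of_absmul_ne_zero h0
  have ho1 : OffAxis (c (σ 1)) := offAxis_of_absmul_ne_zero h1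
  have c0 := two_le_colevel_of_offAxis _ ho0
  have c1 := two_le_colevel_of_offAxis _ ho1
  have r0 := h3 c (LeggedFloor.mem_supp_of_memN D hc) (σ 0)
  have r1 := h3 c (LeggedFloor.mem_supp_of_memN D hc) (σ 1)
  by_cases h3c : (c (σ 3)).colevel = 0
  · have hch : ∀ f : Fin 4, f ≠ σ 3 → (c f).colevel ≠ 0 :=
      forall_slot_of_perm σ (P := fun f => f ≠ σ 3 → (c f).colevel ≠ 0) (fun _ => by omega) (fun _ => by omega)
        (fun _ => h2) (fun h33 => absurd rfl h33)
    by_cases e0 : (c (σ 0)).colevel = 3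
    · exact noN_col3_oneHub hD hr hdis h3 hB hc (perm_ne σ (by decide)) e0 h3c hch
    by_cases e1 : (c (σ 1)).colevel = 3
    · exact noN_col3_oneHub hD hr hdis h3 hB hc (perm_ne σ (by decide)) e1 h3c hch
    exact noN_col2_off2_hub hD hr hdis h3 hB hc (i := σ 1) (k := σ 0) (j := σ 3) (perm_ne σ (by decide))
      (perm_ne σ (by decide)) (perm_ne σ (by decide)) (by omega) ho0 h3c hch
  · have hfree : ∀ f : Fin 4, (c f).colevel ≠ 0 :=
      forall_slot_of_perm σ (P := fun f => (c f).colevel ≠ 0) (by omega) (by omega) h2 h3c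
    exact hubfreeN_onAxis hD hr hdis hB hc hfree (σ 0) ho0

/-- under (B) (+ ring 3): `a2220∘σ` vanishes on the N support — no N off-axis triple. -/
theorem N_a2220_zero_B {h : ℤ} {D : Design} (hD : D.OnAlphabet h) (hr : RuleD D) (hdis : Disj D) (h3 : Ring3 D)
    (hB : HubfreePB D) (σ : Equiv.Perm (Fin 4)) : ∀ c ∈ D.suppN, a2220 σ c = 0 := by
  intro c hc
  by_contra hne
  unfold a2220 at hne
  obtain ⟨h01, h2⟩ := mul_ne_zero_iff.mp hne
  obtain ⟨h0, h1⟩ := mul_ne_zero_iff.mp h01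
  have ho0 : OffAxis (c (σ 0)) := offAxis_of_absmul_ne_zero h0
  have ho1 : OffAxis (c (σ 1)) := offAxis_of_absmul_ne_zero h1
  have ho2 : OffAxis (c (σ 2)) := offAxis_of_absmul_ne_zero h2
  have c0 := two_le_colevel_of_offAxis _ ho0
  have c1 := two_le_colevel_of_offAxis _ ho1
  have c2 := two_le_colevel_of_offAxis _ ho2
  have r0 := h3 c (LeggedFloor.mem_supp_of_memN D hc) (σ 0)
  have r1 := h3 c (LeggedFloor.mem_supp_of_memN D hc) (σ 1)
  by_cases h3c : (c (σ 3)).colevel = 0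
  · have hch : ∀ f : Fin 4, f ≠ σ 3 → (c f).colevel ≠ 0 :=
      forall_slot_of_perm σ (P := fun f => f ≠ σ 3 → (c f).colevel ≠ 0) (fun _ => by omega) (fun _ => by omega)
        (fun _ => by omega) (fun h33 => absurd rfl h33)
    by_cases e0 : (c (σ 0)).colevel = 3
    · exact noN_col3_oneHub hD hr hdis h3 hB hc (perm_ne σ (by decide)) e0 h3c hch
    by_cases e1 : (c (σ 1)).colevel = 3
    · exact noN_col3_oneHub hD hr hdis h3 hB hc (perm_ne σ (by decide)) e1 h3c hch
    exact noN_col2_off2_hub hD hr hdis h3 hB hc (i := σ 1) (k := σ 0) (j := σ 3) (perm_ne σ (by decide))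
      (perm_ne σ (by decide)) (perm_ne σ (by decide)) (by omega) ho0 h3c hch
  · have hfree : ∀ f : Fin 4, (c f).colevel ≠ 0 :=
      forall_slot_of_perm σ (P := fun f => (c f).colevel ≠ 0) (by omega) (by omega) (by omega) h3c
    exact hubfreeN_onAxis hD hr hdis hB hc hfree (σ 0) ho0

/-- **HOOK LAW under (B)**: for ALL placements `σ, σ′`, `2·Σ_P m a2111∘σ′ = 4·Σ_P m a2210∘σ` — the P `Buuu`-mass read at the slot
`σ′0` is twice the P «off-axis pair on `σ{0,1}`, weighted by the co-level at `σ2`» mass; in particular both are placement-free. -/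
theorem hook_law_B {h : ℤ} {D : Design} (hD : D.OnAlphabet h) (h1 : D.A1) (hr : RuleD D) (hdis : Disj D) (h3 : Ring3 D)
    (hB : HubfreePB D) (σ σ' : Equiv.Perm (Fin 4)) : 2 * linZ D.P (a2111 σ') = 4 * linZ D.P (a2210 σ) := by
  have hlaw := hook_slot_law hD h1 σ σ' (N_a2111_zero_B hD hr hdis hB σ')
  rw [linZ_N_eq_zero_of_supp D _ (N_a2210_zero_B hD hr hdis h3 hB σ)] at hlaw
  omega

/-- corollary: the P hook mass is the same at every slot and the P off-axis-pair/col mass the same at every class. -/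
theorem hook_mass_placement_free {h : ℤ} {D : Design} (hD : D.OnAlphabet h) (h1 : D.A1) (hr : RuleD D) (hdis : Disj D)
    (h3 : Ring3 D) (hB : HubfreePB D) (σ σ' τ τ' : Equiv.Perm (Fin 4)) :
    linZ D.P (a2111 σ') = linZ D.P (a2111 τ') ∧ linZ D.P (a2210 σ) = linZ D.P (a2210 τ) := by
  have e1 := hook_law_B hD h1 hr hdis h3 hB σ σ'
  have e2 := hook_law_B hD h1 hr hdis h3 hB τ τ'
  have e3 := hook_law_B hD h1 hr hdis h3 hB σ τ'
  constructor <;> omega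

/-- under (B): no P off-axis hook at one placement `σ′` (no P `Buuu` seen from the slot `σ′0`, i.e. `b′ = 0`) ⇒ no P cell is
«off-axis on `σ{0,1}` with a charged letter at `σ2`» at ANY placement (P `BBHu = ∅`, P `ABBH = BBBH = BDHu = ∅` again). -/
theorem P_a2210_zero_of_noHook_B {h : ℤ} {D : Design} (hD : D.OnAlphabet h) (h1 : D.A1) (hr : RuleD D) (hdis : Disj D)
    (h3 : Ring3 D) (hB : HubfreePB D) (σ σ' : Equiv.Perm (Fin 4)) (hP : ∀ c ∈ D.suppP, a2111 σ' c = 0) :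
    ∀ c ∈ D.suppP, a2210 σ c = 0 := by
  have hlaw := hook_law_B hD h1 hr hdis h3 hB σ σ'
  rw [linZ_P_eq_zero_of_supp D _ hP] at hlaw
  have h0 : linZ D.P (a2210 σ) = 0 := by omega
  intro c hc
  obtain ⟨m, hm, hp⟩ := (mem_suppP_iff D c).mp hc
  exact vanish_of_linZ_eq_zero D.P (a2210 σ) (a2210_nonneg σ) h0 hm hp

/-- the converse: no P «off-axis pair + charged third» at one placement ⇒ no P off-axis hook anywhere (P `Buuu = ∅`). -/
theorem P_a2111_zero_of_noPair_B {h : ℤ} {D : Design} (hD : D.OnAlphabet h) (h1 : D.A1) (hr : RuleD D) (hdis : Disj D)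
    (h3 : Ring3 D) (hB : HubfreePB D) (σ σ' : Equiv.Perm (Fin 4)) (hP : ∀ c ∈ D.suppP, a2210 σ c = 0) :
    ∀ c ∈ D.suppP, a2111 σ' c = 0 := by
  have hlaw := hook_law_B hD h1 hr hdis h3 hB σ σ'
  rw [linZ_P_eq_zero_of_supp D _ hP] at hlaw
  have h0 : linZ D.P (a2111 σ') = 0 := by omega
  intro c hc
  obtain ⟨m, hm, hp⟩ := (mem_suppP_iff D c).mp hc
  exact vanish_of_linZ_eq_zero D.P (a2111 σ') (a2111_nonneg σ') h0 hm hp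

/-- **no P off-axis triple under (B)** (the §11 b-law exclusion with its three support hypotheses discharged). -/
theorem offaxis_triple_free_B {h : ℤ} {D : Design} (hD : D.OnAlphabet h) (h1 : D.A1) (hr : RuleD D) (hdis : Disj D)
    (h3 : Ring3 D) (hB : HubfreePB D) (σ : Equiv.Perm (Fin 4)) : ∀ c ∈ D.suppP, a2220 σ c = 0 :=
  offaxis_triple_free hD h1 σ σ (N_a2220_zero_B hD hr hdis h3 hB σ) (N_a2211_zero_B hD hr hdis hB σ) (P_a2211_zero_B hB σ)

/-- with §11c: at `E = −8` (and `Σ_P m·dep ≥ 9`) the forced hub-free N cell is ON-AXIS at every slot (letters `u`, `A`, `C` only). -/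
theorem hubfreeN_onAxis_of_E_eq {h : ℤ} {D : Design} (hD : D.OnAlphabet h) (hr : RuleD D) (hdis : Disj D)
    (hB : HubfreePB D) (hE : E h D = -8) (hcov : 9 ≤ linZ D.P (dep h)) :
    ∃ cm ∈ D.N, 0 < cm.2 ∧ (∀ f : Fin 4, 0 < (cm.1 f).colevel) ∧ ∀ f : Fin 4, ¬ OffAxis (cm.1 f) := by
  obtain ⟨cm, hm, hp, hpos⟩ := hubfreeN_of_E_eq hD hE hcov
  have hc : cm.1 ∈ D.suppN := (mem_suppN_iff D cm.1).mpr ⟨cm.2, hm, hp⟩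
  exact ⟨cm, hm, hp, hpos, fun f => hubfreeN_onAxis hD hr hdis hB hc (fun g => (hpos g).ne') f⟩

end Discharge

end Summit.HodgeConjecture.HodgeConjecture.Cruxes.BlochSeedDiscOne.ShellThreePropagationB
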